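import Mathlib
import Summits.RiemannHypothesis.RiemannHypothesis.Theorems.WeilFarFloorLogRieszExplicit
import Summits.RiemannHypothesis.RiemannHypothesis.Theorems.WeilFarFloorCoshTest
import Summits.RiemannHypothesis.RiemannHypothesis.Theorems.WeilFarFloorMainTermExact
import HarnessLib

/-!
# The floor law's constant `−2γ_E` and its zero-sum residual, DERIVED for the cosh test function

Helper file (`--supports stmt-RiemannHypothesis-0098`, lead-track anchor: Weil-positivity window ladder, format-C far bound),
pure proofs.  Seat rh-explicit-weil-1 gen10 (memo `run/shared/lean/pub/rh-explicit/rh-explicit-weil-1/FORMAT-K3.md` §11).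
STRUCTURE.md law C-XIII: `λ_max(a) = L(a) − 2γ_E + ε(a)`, `L = pntFloor`, `|ε| ≤ C` (blind 6/6, `|ε| ≤ 0.015`).  For the floor's
near-extremizer `χ_a = cosh(·/2)·1_{[−a,a]}` (`WeilFarFloorCoshTest`: `Q_a(χ_a) = S(a)`, `‖χ_a‖² = a + sinh a`), the companion
`WeilFarFloorLogRieszExplicit` (explicit formula for `W = ∫ψ/t`), Mertens in sharp form (`Σ_{n≤x}Λ(n)/n − log x → −γ`, Literature
`tendsto_sum_vonMangoldt_div_sub_log`) and the PNT give, with `Z(a) := Re Σ_ρ m(ρ)e^{2aρ}/ρ² / (2(a + sinh a))` (absolutely convergent):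
§1–§2 **`S(a)/(a + sinh a) − (e^a + 2a − 2 − 2γ) + Z(a) → 0`** (`tendsto_coshSum_div`, UNCONDITIONAL) — the law's `−2γ_E` is the Mertens
constant of `e^a·Σ_{n≤e^{2a}}Λ(n)/n` and its residual is minus the zero sum; §3 UNDER RH `|Z(a)| ≤ β = Σ_ρ m(ρ)/|ρ|² = 2 + γ − log 4π < 0.0474`
(`a ≥ 1/2`), so `|S(a)/(a + sinh a) − (e^a + 2a − 2 − 2γ)| ≤ β + ε` eventually; §4 for the floor itself (`pntFloor a = e^a + 2a − 2 + o(1)`,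
`WeilFarFloorMainTermExact`): **`R(a) − (pntFloor a − 2γ) + Z(a) → 0`** for the Rayleigh quotient `R(a) = Q_a(χ_a)/‖χ_a‖² ≤ λ_max(a)`, hence
`∀ ε > 0, ∀ᶠ a, pntFloor a − 2γ − Z(a) − ε ≤ λ_max(a)` (UNCONDITIONAL) and UNDER RH **`∀ ε > 0, ∀ᶠ a, −(β + ε) ≤ λ_max(a) − (pntFloor a − 2γ)`**
— the LOWER clause of C-XIII with the explicit constant `β + ε` (the tree's `WeilFarFloorCoshTestRH` has `∃ C`).  Standard axioms only; RH
statements take Mathlib's `RiemannHypothesis` as a hypothesis.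
-/

set_option linter.dupNamespace false
set_option autoImplicit false

noncomputable section

open MeasureTheory Set Filter Topology
open scoped Real BigOperators ArithmeticFunction.vonMangoldt Chebyshev

namespace Summit.RiemannHypothesis.RiemannHypothesis.Theorems.WeilFormatC

namespace FloorCoshZeroSum

open Literature.NumberTheory.LFunctions NicolasJExplicit LogRieszExplicit

/-- Transport of a limit along an evaluation of its limit value to `0`. -/
theorem tendsto_zero_of_eq {f : ℝ → ℝ} {x : ℝ} (h : Tendsto f atTop (𝓝 x)) (e : x = 0) : Tendsto f atTop (𝓝 0) :=
  e ▸ h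

/-! ## §1 The numerator through `M`, `ψ`, `W` and `V` -/

/-- **`S(a) = e^a·M − e^{−a}ψ(e^{2a}) + ½W(e^{2a}) + ½V`** with `M = Σ_{n≤e^{2a}}Λ(n)/n`, `W(Y) = ∫₁^Y ψ(t)dt/t = Σ_{n≤Y}Λ(n)log(Y/n)`,
`V = Σ_{n≤e^{2a}}Λ(n)(2a − log n)/n`. -/
theorem coshSum_eq (a : ℝ) :
    (∑ n ∈ Finset.Ioc 0 ⌊Real.exp (2 * a)⌋₊,
      (Λ n : ℝ) * (Real.exp a / n - Real.exp (-a) + (2 * a - Real.log n) * (1 + 1 / n) / 2)) = Real.exp a * (∑ n ∈ Finset.Ioc 0 ⌊Real.exp (2 * a)⌋₊, (Λ n : ℝ) / n)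
      - Real.exp (-a) * ψ (Real.exp (2 * a)) + (1 / 2) * (∫ t in Ioc 1 (Real.exp (2 * a)), t⁻¹ * ψ t)
      + (1 / 2) * ∑ n ∈ Finset.Ioc 0 ⌊Real.exp (2 * a)⌋₊, (Λ n : ℝ) * (2 * a - Real.log n) / n := by
  have hψ : ψ (Real.exp (2 * a)) = ∑ n ∈ Finset.Ioc 0 ⌊Real.exp (2 * a)⌋₊, (Λ n : ℝ) := rfl
  have hW : ∫ t in Ioc 1 (Real.exp (2 * a)), t⁻¹ * ψ t
      = ∑ n ∈ Finset.Ioc 0 ⌊Real.exp (2 * a)⌋₊, (2 * a - Real.log n) * (Λ n : ℝ) := by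
    rw [← FloorCosh.sum_vonMangoldt_mul_log_div_eq_integral, Real.log_exp]
    exact (Finset.sum_subset Finset.Ioc_subset_Icc_self fun n hn hn' ↦ by
      have h0 : n = 0 := by rw [Finset.mem_Icc] at hn; rw [Finset.mem_Ioc] at hn'; omega
      subst h0; simp).symm
  rw [hψ, hW, Finset.mul_sum, Finset.mul_sum, Finset.mul_sum, Finset.mul_sum, ← Finset.sum_sub_distrib,
    ← Finset.sum_add_distrib, ← Finset.sum_add_distrib]
  refine Finset.sum_congr rfl fun n _ ↦ ?_
  ring

/-! ## §2 The limit -/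

/-- Mertens in sharp form along `Y = e^{2a}`: `Σ_{n≤e^{2a}} Λ(n)/n − 2a → −γ`. -/
theorem tendsto_vonMangoldt_div_sum :
    Tendsto (fun a : ℝ ↦ ∑ n ∈ Finset.Ioc 0 ⌊Real.exp (2 * a)⌋₊, (Λ n : ℝ) / n - 2 * a) atTop
      (𝓝 (-Real.eulerMascheroniConstant)) := by
  have htwo : Tendsto (fun a : ℝ ↦ Real.exp (2 * a)) atTop atTop :=
    Real.tendsto_exp_atTop.comp (tendsto_id.const_mul_atTop two_pos)
  have h := tendsto_sum_vonMangoldt_div_sub_log.comp htwo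
  refine h.congr fun a ↦ ?_
  simp only [Function.comp, Real.log_exp]

/-- PNT along `Y = e^{2a}`: `ψ(e^{2a})/e^{2a} → 1`. -/
theorem tendsto_psi_div_exp : Tendsto (fun a : ℝ ↦ ψ (Real.exp (2 * a)) / Real.exp (2 * a)) atTop (𝓝 1) := by
  have htwo : Tendsto (fun a : ℝ ↦ Real.exp (2 * a)) atTop atTop :=
    Real.tendsto_exp_atTop.comp (tendsto_id.const_mul_atTop two_pos)
  exact Literature.NumberTheory.Transcendental.tendsto_psi_div.comp htwo

/-- `e^a/(a + sinh a) → 2` (`(a + sinh a)/e^a = a e^{−a} + (1 − e^{−2a})/2 → 1/2`). -/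
theorem tendsto_exp_div_norm : Tendsto (fun a : ℝ ↦ Real.exp a / (a + Real.sinh a)) atTop (𝓝 2) := by
  have hu := Real.tendsto_exp_neg_atTop_nhds_zero
  have hv : Tendsto (fun a : ℝ ↦ a * Real.exp (-a)) atTop (𝓝 0) := by
    simpa using Real.tendsto_pow_mul_exp_neg_atTop_nhds_zero 1
  have h1 : Tendsto (fun a : ℝ ↦ a * Real.exp (-a) + (1 - Real.exp (-a) ^ 2) / 2) atTop (𝓝 (0 + (1 - 0 ^ 2) / 2)) :=
    hv.add ((tendsto_const_nhds.sub (hu.pow 2)).div_const 2)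
  rw [show (0 : ℝ) + (1 - 0 ^ 2) / 2 = 2⁻¹ by norm_num] at h1
  have h2 := h1.inv₀ (by norm_num)
  rw [inv_inv] at h2
  refine h2.congr fun a ↦ ?_
  have hE : Real.exp a ≠ 0 := (Real.exp_pos a).ne'
  rw [Real.sinh_eq, Real.exp_neg, ← inv_div (a + _) (Real.exp a)]
  congr 1
  field_simp

/-- The algebra of the limit (valid for any `D ≠ 0`, `E ≠ 0`): with `ψ(Y) = P·E²`, `W = B + E² − Z − 2a·c`,
`S/D − (E + 2a − 2 − 2γ) + Z/(2D)` splits into eight terms. -/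
theorem split_identity {E D a M P B V Z γ c : ℝ} (hE : E ≠ 0) (hD : D ≠ 0) :
    (E * M - E⁻¹ * (P * E ^ 2) + 1 / 2 * (B + E ^ 2 - Z - 2 * a * c) + 1 / 2 * V) / D
        - (E + 2 * a - 2 - 2 * γ) + Z / (2 * D)
      = (E / D) * (M - 2 * a + γ) + (E / D - 2) * (2 * a - γ) - (E / D) * (P - 1) - (E / D - 2)
        + (E / D) * E⁻¹ * B / 2 + (E ^ 2 / (2 * D) - E + 2 * a) - c * ((E / D) * (a * E⁻¹)) + (E / D) * E⁻¹ * V / 2 := by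
  field_simp
  ring

/-- `E/D − 2 = (E/D)·(E⁻² − 2aE⁻¹)` when `2D = 2a + E − E⁻¹` (`D = a + sinh a`, `E = e^a`). -/
theorem exp_div_sub_two {E D a : ℝ} (hE : E ≠ 0) (hD : D ≠ 0) (h2D : 2 * D = 2 * a + E - E⁻¹) :
    E / D - 2 = (E / D) * (E⁻¹ ^ 2 - 2 * (a * E⁻¹)) := by
  have h1 : E / D - 2 = (E - 2 * D) / D := by field_simp
  rw [h1, h2D]
  field_simp
  ring

/-- `E²/(2D) − E + 2a = (E/D)·(E⁻¹ + 4a²E⁻¹ − 2aE⁻²)/2` when `2D = 2a + E − E⁻¹`. -/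
theorem sq_div_sub {E D a : ℝ} (hE : E ≠ 0) (hD : D ≠ 0) (h2D : 2 * D = 2 * a + E - E⁻¹) :
    E ^ 2 / (2 * D) - E + 2 * a = (E / D) * (E⁻¹ + 4 * (a ^ 2 * E⁻¹) - 2 * (E⁻¹ * (a * E⁻¹))) / 2 := by
  have h1 : E ^ 2 / (2 * D) - E + 2 * a = (E ^ 2 - E * (2 * a + E - E⁻¹) + 2 * a * (2 * a + E - E⁻¹)) / (2 * D) := by
    rw [← h2D]
    field_simp
  rw [h1]
  field_simp
  ring

/-- `2(a + sinh a) = 2a + e^a − (e^a)⁻¹` and `a + sinh a > 0` for `a ≥ 1`. -/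
theorem norm_facts {a : ℝ} (ha : 1 ≤ a) :
    2 * (a + Real.sinh a) = 2 * a + Real.exp a - (Real.exp a)⁻¹ ∧ 0 < a + Real.sinh a := by
  refine ⟨by rw [Real.sinh_eq, Real.exp_neg]; ring, ?_⟩
  have := Real.sinh_nonneg_iff.2 (show 0 ≤ a by linarith)
  linarith

/-- **The cosh-test asymptotics with the zero sum** (UNCONDITIONAL): for `S(a) = Σ_{n≤e^{2a}} Λ(n)(e^a/n − e^{−a} + (2a − log n)(1+1/n)/2)`
(`= Q_a(cosh(·/2)·1_{[−a,a]})`, `‖χ_a‖² = a + sinh a`),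
**`S(a)/(a + sinh a) − (e^a + 2a − 2 − 2γ) + Re(Σ_ρ m(ρ)e^{2aρ}/ρ²)/(2(a + sinh a)) → 0`** as `a → ∞`
(the sum over the non-trivial zeros of `ζ`, with multiplicity, converging absolutely; `e^{2aρ} = (e^{2a})^ρ`). -/
theorem tendsto_coshSum_div :
    Tendsto (fun a : ℝ ↦ (∑ n ∈ Finset.Ioc 0 ⌊Real.exp (2 * a)⌋₊,
      (Λ n : ℝ) * (Real.exp a / n - Real.exp (-a) + (2 * a - Real.log n) * (1 + 1 / n) / 2)) / (a + Real.sinh a) - (Real.exp a + 2 * a - 2 - 2 * Real.eulerMascheroniConstant)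
      + ((∑' ρ : Zeros, (riemannZetaZeroOrder (ρ : ℂ) : ℂ) * ((((Real.exp (2 * a) : ℝ)) : ℂ) ^ (ρ : ℂ) / (ρ : ℂ) ^ 2))).re / (2 * (a + Real.sinh a))) atTop (𝓝 0) := by
  obtain ⟨C, hC⟩ := exists_abs_logRiesz_sub_le
  set γ := Real.eulerMascheroniConstant with hγ
  set c := Real.log (2 * π) with hc
  -- the primitive limits (`u = e^{−a}`, `v = a e^{−a}`, `w = a² e^{−a}`, `Q = e^a/(a + sinh a)`)
  have hu : Tendsto (fun a : ℝ ↦ (Real.exp a)⁻¹) atTop (𝓝 0) :=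
    Real.tendsto_exp_neg_atTop_nhds_zero.congr fun a ↦ Real.exp_neg a
  have hv : Tendsto (fun a : ℝ ↦ a * (Real.exp a)⁻¹) atTop (𝓝 0) :=
    (Real.tendsto_pow_mul_exp_neg_atTop_nhds_zero 1).congr fun a ↦ by rw [pow_one, Real.exp_neg]
  have hw : Tendsto (fun a : ℝ ↦ a ^ 2 * (Real.exp a)⁻¹) atTop (𝓝 0) :=
    (Real.tendsto_pow_mul_exp_neg_atTop_nhds_zero 2).congr fun a ↦ by rw [Real.exp_neg]
  have hQ := tendsto_exp_div_norm
  have hM : Tendsto (fun a : ℝ ↦ ∑ n ∈ Finset.Ioc 0 ⌊Real.exp (2 * a)⌋₊, (Λ n : ℝ) / n - 2 * a + γ) atTop (𝓝 0) := by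
    have := tendsto_vonMangoldt_div_sum.add_const γ
    rwa [neg_add_cancel] at this
  have hP : Tendsto (fun a : ℝ ↦ ψ (Real.exp (2 * a)) / Real.exp (2 * a) - 1) atTop (𝓝 0) := by
    have := tendsto_psi_div_exp.sub_const 1
    rwa [sub_self] at this
  -- the eight terms
  have h1 : Tendsto (fun a : ℝ ↦ (Real.exp a / (a + Real.sinh a))
      * (∑ n ∈ Finset.Ioc 0 ⌊Real.exp (2 * a)⌋₊, (Λ n : ℝ) / n - 2 * a + γ)) atTop (𝓝 0) :=
    tendsto_zero_of_eq (hQ.mul hM) (by norm_num)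
  have h2 : Tendsto (fun a : ℝ ↦ (Real.exp a / (a + Real.sinh a) - 2) * (2 * a - γ)) atTop (𝓝 0) := by
    have h := tendsto_zero_of_eq (hQ.mul ((((hu.mul hv).const_mul 2).sub ((hu.pow 2).const_mul γ)).sub (hw.const_mul 4)
      |>.add (hv.const_mul (2 * γ)))) (by norm_num)
    refine h.congr' ?_
    filter_upwards [eventually_ge_atTop 1] with a ha
    obtain ⟨h2D, hD⟩ := norm_facts ha
    rw [exp_div_sub_two (Real.exp_pos a).ne' hD.ne' h2D]
    ring
  have h3 : Tendsto (fun a : ℝ ↦ (Real.exp a / (a + Real.sinh a)) * (ψ (Real.exp (2 * a)) / Real.exp (2 * a) - 1))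
      atTop (𝓝 0) := tendsto_zero_of_eq (hQ.mul hP) (by norm_num)
  have h4 : Tendsto (fun a : ℝ ↦ Real.exp a / (a + Real.sinh a) - 2) atTop (𝓝 0) :=
    tendsto_zero_of_eq (hQ.sub_const 2) (by norm_num)
  have h6 : Tendsto (fun a : ℝ ↦ Real.exp a ^ 2 / (2 * (a + Real.sinh a)) - Real.exp a + 2 * a) atTop (𝓝 0) := by
    have h := tendsto_zero_of_eq ((hQ.mul ((hu.add (hw.const_mul 4)).sub ((hu.mul hv).const_mul 2))).div_const 2)
      (by norm_num)
    refine h.congr' ?_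
    filter_upwards [eventually_ge_atTop 1] with a ha
    obtain ⟨h2D, hD⟩ := norm_facts ha
    rw [sq_div_sub (Real.exp_pos a).ne' hD.ne' h2D]
  have h7 : Tendsto (fun a : ℝ ↦ c * (Real.exp a / (a + Real.sinh a) * (a * (Real.exp a)⁻¹))) atTop (𝓝 0) :=
    tendsto_zero_of_eq ((hQ.mul hv).const_mul c) (by norm_num)
  -- the two squeezed terms: `B/(2D)` with `|B| ≤ C`, and `V/(2D)` with `0 ≤ V ≤ 2a·M`
  have hQu : Tendsto (fun a : ℝ ↦ (Real.exp a / (a + Real.sinh a)) * (Real.exp a)⁻¹) atTop (𝓝 0) :=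
    tendsto_zero_of_eq (hQ.mul hu) (by norm_num)
  have h5 : Tendsto (fun a : ℝ ↦ (Real.exp a / (a + Real.sinh a)) * (Real.exp a)⁻¹
      * ((∫ t in Ioc 1 (Real.exp (2 * a)), t⁻¹ * ψ t) - Real.exp (2 * a) + ((∑' ρ : Zeros, (riemannZetaZeroOrder (ρ : ℂ) : ℂ) * ((((Real.exp (2 * a) : ℝ)) : ℂ) ^ (ρ : ℂ) / (ρ : ℂ) ^ 2))).re
          + c * Real.log (Real.exp (2 * a))) / 2) atTop (𝓝 0) := by
    have hb : Tendsto (fun a : ℝ ↦ |(Real.exp a / (a + Real.sinh a)) * (Real.exp a)⁻¹| * C / 2) atTop (𝓝 0) :=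
      tendsto_zero_of_eq ((hQu.abs.mul_const C).div_const 2) (by norm_num)
    refine squeeze_zero_norm' ?_ hb
    filter_upwards [eventually_ge_atTop 0] with a ha
    rw [Real.norm_eq_abs, abs_div, abs_mul, abs_two]
    gcongr
    exact hC _ (Real.one_le_exp (by linarith))
  have h8 : Tendsto (fun a : ℝ ↦ (Real.exp a / (a + Real.sinh a)) * (Real.exp a)⁻¹
      * (∑ n ∈ Finset.Ioc 0 ⌊Real.exp (2 * a)⌋₊, (Λ n : ℝ) * (2 * a - Real.log n) / n) / 2) atTop (𝓝 0) := by
    have hb : Tendsto (fun a : ℝ ↦ (Real.exp a / (a + Real.sinh a)) * ((a * (Real.exp a)⁻¹)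
        * (∑ n ∈ Finset.Ioc 0 ⌊Real.exp (2 * a)⌋₊, (Λ n : ℝ) / n - 2 * a + γ) + 2 * (a ^ 2 * (Real.exp a)⁻¹)
          - γ * (a * (Real.exp a)⁻¹))) atTop (𝓝 0) :=
      tendsto_zero_of_eq (hQ.mul (((hv.mul hM).add (hw.const_mul 2)).sub (hv.const_mul γ))) (by norm_num)
    refine squeeze_zero' ?_ ?_ hb
    · filter_upwards [eventually_ge_atTop 0] with a ha
      have hD : 0 ≤ a + Real.sinh a := by have := Real.sinh_nonneg_iff.2 ha; positivity
      refine div_nonneg (mul_nonneg (mul_nonneg (div_nonneg (Real.exp_pos a).le hD) (inv_nonneg.2 (Real.exp_pos a).le))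
        (Finset.sum_nonneg fun n hn ↦ ?_)) two_pos.le
      rw [Finset.mem_Ioc] at hn
      have hn0 : (0 : ℝ) < n := by exact_mod_cast hn.1
      have hlog : Real.log n ≤ 2 * a := by
        rw [Real.log_le_iff_le_exp hn0]; exact (Nat.cast_le.2 hn.2).trans (Nat.floor_le (Real.exp_pos _).le)
      exact div_nonneg (mul_nonneg ArithmeticFunction.vonMangoldt_nonneg (by linarith)) hn0.le
    · filter_upwards [eventually_ge_atTop 0] with a ha
      have hD : 0 ≤ a + Real.sinh a := by have := Real.sinh_nonneg_iff.2 ha; positivity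
      have hQ0 : 0 ≤ Real.exp a / (a + Real.sinh a) * (Real.exp a)⁻¹ :=
        mul_nonneg (div_nonneg (Real.exp_pos a).le hD) (inv_nonneg.2 (Real.exp_pos a).le)
      have hVle : ∑ n ∈ Finset.Ioc 0 ⌊Real.exp (2 * a)⌋₊, (Λ n : ℝ) * (2 * a - Real.log n) / n
          ≤ 2 * a * ∑ n ∈ Finset.Ioc 0 ⌊Real.exp (2 * a)⌋₊, (Λ n : ℝ) / n := by
        rw [Finset.mul_sum]
        refine Finset.sum_le_sum fun n hn ↦ ?_
        rw [Finset.mem_Ioc] at hn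
        have hn0 : (0 : ℝ) < n := by exact_mod_cast hn.1
        have hlog0 : 0 ≤ Real.log n := Real.log_nonneg (by exact_mod_cast hn.1)
        rw [mul_comm ((Λ n : ℝ)), mul_div_assoc]
        exact mul_le_mul_of_nonneg_right (by linarith) (div_nonneg ArithmeticFunction.vonMangoldt_nonneg hn0.le)
      have e : Real.exp a / (a + Real.sinh a) * (a * (Real.exp a)⁻¹
            * (∑ n ∈ Finset.Ioc 0 ⌊Real.exp (2 * a)⌋₊, (Λ n : ℝ) / n - 2 * a + γ)
            + 2 * (a ^ 2 * (Real.exp a)⁻¹) - γ * (a * (Real.exp a)⁻¹))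
          = Real.exp a / (a + Real.sinh a) * (Real.exp a)⁻¹
            * (2 * a * ∑ n ∈ Finset.Ioc 0 ⌊Real.exp (2 * a)⌋₊, (Λ n : ℝ) / n) / 2 := by
        ring
      rw [e]
      gcongr
  -- assembling
  have hsum := ((((((h1.add h2).sub h3).sub h4).add h5).add h6).sub h7).add h8
  rw [show ((0 : ℝ) + 0 - 0 - 0 + 0 + 0 - 0 + 0) = 0 by norm_num] at hsum
  refine hsum.congr' ?_
  filter_upwards [eventually_ge_atTop 1] with a ha
  have hE := Real.exp_pos a
  obtain ⟨-, hD⟩ := norm_facts ha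
  have hEa : Real.exp (2 * a) = Real.exp a ^ 2 := by rw [← Real.exp_nat_mul]; norm_num
  have hid := split_identity (M := ∑ n ∈ Finset.Ioc 0 ⌊Real.exp (2 * a)⌋₊, (Λ n : ℝ) / n)
    (P := ψ (Real.exp (2 * a)) / Real.exp (2 * a))
    (B := (∫ t in Ioc 1 (Real.exp (2 * a)), t⁻¹ * ψ t) - Real.exp (2 * a) + ((∑' ρ : Zeros, (riemannZetaZeroOrder (ρ : ℂ) : ℂ) * ((((Real.exp (2 * a) : ℝ)) : ℂ) ^ (ρ : ℂ) / (ρ : ℂ) ^ 2))).re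
      + c * Real.log (Real.exp (2 * a)))
    (V := ∑ n ∈ Finset.Ioc 0 ⌊Real.exp (2 * a)⌋₊, (Λ n : ℝ) * (2 * a - Real.log n) / n)
    (Z := ((∑' ρ : Zeros, (riemannZetaZeroOrder (ρ : ℂ) : ℂ) * ((((Real.exp (2 * a) : ℝ)) : ℂ) ^ (ρ : ℂ) / (ρ : ℂ) ^ 2))).re) (a := a) (γ := γ) (c := c) hE.ne' hD.ne'
  rw [coshSum_eq, Real.exp_neg]
  rw [Real.log_exp, hEa] at hid ⊢
  have hPe : ψ (Real.exp a ^ 2) / Real.exp a ^ 2 * Real.exp a ^ 2 = ψ (Real.exp a ^ 2) := by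
    field_simp
  have hB : (∫ t in Ioc 1 (Real.exp a ^ 2), t⁻¹ * ψ t) - Real.exp a ^ 2 + ((∑' ρ : Zeros, (riemannZetaZeroOrder (ρ : ℂ) : ℂ) * ((((Real.exp a ^ 2 : ℝ)) : ℂ) ^ (ρ : ℂ) / (ρ : ℂ) ^ 2))).re + c * (2 * a)
      + Real.exp a ^ 2 - ((∑' ρ : Zeros, (riemannZetaZeroOrder (ρ : ℂ) : ℂ) * ((((Real.exp a ^ 2 : ℝ)) : ℂ) ^ (ρ : ℂ) / (ρ : ℂ) ^ 2))).re - 2 * a * c = ∫ t in Ioc 1 (Real.exp a ^ 2), t⁻¹ * ψ t := by ring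
  rw [hPe, hB] at hid
  rw [← hid]

/-! ## §3 Under RH: the zero term is at most `β = Σ_ρ m(ρ)/|ρ|² = 2 + γ − log 4π` -/

/-- Under RH, `‖Σ_ρ m(ρ)Y^ρ/ρ²‖ ≤ β·√Y` for `Y ≥ 1` (`|Y^ρ| = √Y`, `Σ_ρ m(ρ)/|ρ|² = β`, Literature
`hasSum_zeroOrder_div_norm_sq_of_RH`). -/
theorem norm_zsq_le_of_RH (hRH : RiemannHypothesis) {Y : ℝ} (hY : 1 ≤ Y) : ‖(∑' ρ : Zeros, (riemannZetaZeroOrder (ρ : ℂ) : ℂ) * ((((Y : ℝ)) : ℂ) ^ (ρ : ℂ) / (ρ : ℂ) ^ 2))‖ ≤ nicolasBeta * Real.sqrt Y := by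
  have hY0 : 0 < Y := by linarith
  refine (norm_tsum_le_tsum_norm (summable_norm_zeroOrder_mul_cpow_div_sq hY)).trans (le_of_eq ?_)
  have hterm : ∀ ρ : Zeros, ‖(riemannZetaZeroOrder (ρ : ℂ) : ℂ) * (((Y : ℝ) : ℂ) ^ (ρ : ℂ) / (ρ : ℂ) ^ 2)‖
      = Real.sqrt Y * ((riemannZetaZeroOrder (ρ : ℂ) : ℝ) / ‖(ρ : ℂ)‖ ^ 2) := by
    intro ρ
    rw [norm_mul, Complex.norm_intCast, abs_of_nonneg (zeroOrder_nonneg' ρ), norm_div, norm_pow,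
      Complex.norm_cpow_eq_rpow_re_of_pos hY0, re_eq_half_of_RH hRH ρ.2, ← Real.sqrt_eq_rpow]
    ring
  rw [tsum_congr hterm, tsum_mul_left, (hasSum_zeroOrder_div_norm_sq_of_RH hRH).tsum_eq, mul_comm]

/-- **Under RH, `|Re Σ_ρ m(ρ)e^{2aρ}/ρ²| / (2(a + sinh a)) ≤ β`** for `a ≥ 1` (`e^a ≤ 2a + e^a − e^{−a}`). -/
theorem abs_zeroSum_div_le_of_RH (hRH : RiemannHypothesis) {a : ℝ} (ha : 1 ≤ a) :
    |((∑' ρ : Zeros, (riemannZetaZeroOrder (ρ : ℂ) : ℂ) * ((((Real.exp (2 * a) : ℝ)) : ℂ) ^ (ρ : ℂ) / (ρ : ℂ) ^ 2))).re / (2 * (a + Real.sinh a))| ≤ nicolasBeta := by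
  obtain ⟨h2D, hD⟩ := norm_facts ha
  have hY : 1 ≤ Real.exp (2 * a) := Real.one_le_exp (by linarith)
  have hsqrt : Real.sqrt (Real.exp (2 * a)) = Real.exp a := by
    rw [show Real.exp (2 * a) = Real.exp a ^ 2 by rw [← Real.exp_nat_mul]; norm_num, Real.sqrt_sq (Real.exp_pos a).le]
  have h1 : |((∑' ρ : Zeros, (riemannZetaZeroOrder (ρ : ℂ) : ℂ) * ((((Real.exp (2 * a) : ℝ)) : ℂ) ^ (ρ : ℂ) / (ρ : ℂ) ^ 2))).re| ≤ nicolasBeta * Real.exp a :=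
    (Complex.abs_re_le_norm _).trans (hsqrt ▸ norm_zsq_le_of_RH hRH hY)
  have hβ : 0 ≤ nicolasBeta := (lt_trans (by norm_num) nicolasBeta_gt).le
  have hE : Real.exp a ≤ 2 * (a + Real.sinh a) := by
    rw [h2D]
    have : (Real.exp a)⁻¹ ≤ 1 := inv_le_one_of_one_le₀ (Real.one_le_exp (by linarith))
    linarith
  rw [abs_div, abs_of_pos (show (0 : ℝ) < 2 * (a + Real.sinh a) by linarith),
    div_le_iff₀ (show (0 : ℝ) < 2 * (a + Real.sinh a) by linarith)]
  exact h1.trans (mul_le_mul_of_nonneg_left hE hβ)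

/-- **Under RH the cosh quotient obeys the floor law with an explicit constant**: for every `ε > 0`, eventually
`|S(a)/(a + sinh a) − (e^a + 2a − 2 − 2γ)| ≤ β + ε`, `β = 2 + γ − log 4π < 0.0474`. -/
theorem eventually_abs_coshSum_div_sub_le_of_RH (hRH : RiemannHypothesis) {ε : ℝ} (hε : 0 < ε) :
    ∀ᶠ a : ℝ in atTop, |(∑ n ∈ Finset.Ioc 0 ⌊Real.exp (2 * a)⌋₊,
      (Λ n : ℝ) * (Real.exp a / n - Real.exp (-a) + (2 * a - Real.log n) * (1 + 1 / n) / 2)) / (a + Real.sinh a) - (Real.exp a + 2 * a - 2 - 2 * Real.eulerMascheroniConstant)|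
      ≤ nicolasBeta + ε := by
  filter_upwards [Metric.tendsto_nhds.1 tendsto_coshSum_div ε hε, eventually_ge_atTop 1] with a h1 ha
  rw [Real.dist_eq, sub_zero] at h1
  have h2 := abs_zeroSum_div_le_of_RH hRH ha
  have h3 := abs_sub ((∑ n ∈ Finset.Ioc 0 ⌊Real.exp (2 * a)⌋₊,
      (Λ n : ℝ) * (Real.exp a / n - Real.exp (-a) + (2 * a - Real.log n) * (1 + 1 / n) / 2)) / (a + Real.sinh a) - (Real.exp a + 2 * a - 2 - 2 * Real.eulerMascheroniConstant)
    + ((∑' ρ : Zeros, (riemannZetaZeroOrder (ρ : ℂ) : ℂ) * ((((Real.exp (2 * a) : ℝ)) : ℂ) ^ (ρ : ℂ) / (ρ : ℂ) ^ 2))).re / (2 * (a + Real.sinh a))) (((∑' ρ : Zeros, (riemannZetaZeroOrder (ρ : ℂ) : ℂ) * ((((Real.exp (2 * a) : ℝ)) : ℂ) ^ (ρ : ℂ) / (ρ : ℂ) ^ 2))).re / (2 * (a + Real.sinh a)))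
  rw [add_sub_cancel_right] at h3
  linarith

/-! ## §4 Consequences for the far-coercivity floor -/

/-- The Rayleigh quotient of `χ_a = cosh(·/2)·1_{[−a,a]}` is `S(a)/(a + sinh a)` and lies below the floor (`a > 0`). -/
theorem coshSum_div_le_farCoercivityFloor {a : ℝ} (ha : 0 < a) :
    (∑ n ∈ Finset.Ioc 0 ⌊Real.exp (2 * a)⌋₊,
      (Λ n : ℝ) * (Real.exp a / n - Real.exp (-a) + (2 * a - Real.log n) * (1 + 1 / n) / 2)) / (a + Real.sinh a) ≤ farCoercivityFloor a := by
  obtain ⟨hm, hb, hs⟩ := FloorCosh.coshTest_admissible a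
  have hnorm := FloorCosh.integral_coshTest_sq ha.le
  have hpos : 0 < ∫ x, (Icc (-a) a).indicator (fun y ↦ Real.cosh (y / 2)) x ^ 2 := by
    rw [hnorm]; have := Real.sinh_pos_iff.2 ha; positivity
  have hle := le_csSup (primeShiftQuotients_bddAbove a)
    ⟨(Icc (-a) a).indicator (fun y ↦ Real.cosh (y / 2)), Real.cosh (a / 2), hm, hb, hs, hpos, rfl⟩
  rwa [FloorCosh.primeShiftForm_coshTest, hnorm] at hle

/-- **The floor law's constant and residual for the cosh quotient, against `pntFloor`** (UNCONDITIONAL):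
`S(a)/(a + sinh a) − (pntFloor a − 2γ) + Re(Σ_ρ m(ρ)e^{2aρ}/ρ²)/(2(a + sinh a)) → 0`
(`pntFloor a − (e^a + 2a) → −2`, `WeilFarFloorMainTermExact`). -/
theorem tendsto_coshSum_div_sub_pntFloor :
    Tendsto (fun a : ℝ ↦ (∑ n ∈ Finset.Ioc 0 ⌊Real.exp (2 * a)⌋₊,
      (Λ n : ℝ) * (Real.exp a / n - Real.exp (-a) + (2 * a - Real.log n) * (1 + 1 / n) / 2)) / (a + Real.sinh a) - (pntFloor a - 2 * Real.eulerMascheroniConstant)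
      + ((∑' ρ : Zeros, (riemannZetaZeroOrder (ρ : ℂ) : ℂ) * ((((Real.exp (2 * a) : ℝ)) : ℂ) ^ (ρ : ℂ) / (ρ : ℂ) ^ 2))).re / (2 * (a + Real.sinh a))) atTop (𝓝 0) := by
  have h2 : Tendsto (fun a : ℝ ↦ pntFloor a - (Real.exp a + 2 * a) + 2) atTop (𝓝 0) :=
    tendsto_zero_of_eq (FloorMainTerm.tendsto_pntFloor_sub.add_const 2) (by norm_num)
  exact (tendsto_zero_of_eq (tendsto_coshSum_div.sub h2) (by norm_num)).congr fun a ↦ by ring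

/-- **UNCONDITIONAL lower bound for the floor with the law's constant and the zero sum**: for every `ε > 0`, eventually
`pntFloor a − 2γ − Re(Σ_ρ m(ρ)e^{2aρ}/ρ²)/(2(a + sinh a)) − ε ≤ λ_max(a)`. -/
theorem eventually_pntFloor_sub_zeroSum_le_floor {ε : ℝ} (hε : 0 < ε) :
    ∀ᶠ a : ℝ in atTop, pntFloor a - 2 * Real.eulerMascheroniConstant
      - ((∑' ρ : Zeros, (riemannZetaZeroOrder (ρ : ℂ) : ℂ) * ((((Real.exp (2 * a) : ℝ)) : ℂ) ^ (ρ : ℂ) / (ρ : ℂ) ^ 2))).re / (2 * (a + Real.sinh a)) - ε ≤ farCoercivityFloor a := by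
  filter_upwards [Metric.tendsto_nhds.1 tendsto_coshSum_div_sub_pntFloor ε hε, eventually_gt_atTop 0] with a h1 ha
  rw [Real.dist_eq, sub_zero] at h1
  have h2 := coshSum_div_le_farCoercivityFloor ha
  have h3 := (abs_lt.1 h1).1
  linarith

/-- **UNDER RH, the lower clause of the floor law C-XIII with an explicit constant**: for every `ε > 0`, eventually
`−(β + ε) ≤ λ_max(a) − (pntFloor a − 2γ)` with `β = Σ_ρ m(ρ)/|ρ|² = 2 + γ − log 4π ∈ (0.045, 0.0474)`
(the tree's `WeilFarFloorCoshTestRH.farFloorDiscrepancy_lower_of_RH` has an unspecified constant). -/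
theorem eventually_farFloorDiscrepancy_ge_of_RH (hRH : RiemannHypothesis) {ε : ℝ} (hε : 0 < ε) :
    ∀ᶠ a : ℝ in atTop,
      -(nicolasBeta + ε) ≤ farCoercivityFloor a - (pntFloor a - 2 * Real.eulerMascheroniConstant) := by
  filter_upwards [eventually_pntFloor_sub_zeroSum_le_floor hε, eventually_ge_atTop 1] with a h1 ha
  have h2 := (abs_le.1 (abs_zeroSum_div_le_of_RH hRH ha)).2
  linarith

/-- **UNDER RH, numerically**: eventually `pntFloor a − 1.202 ≤ λ_max(a)` (`2γ < 1.15444`, `β < 0.0474`). -/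
theorem eventually_pntFloor_sub_le_floor_of_RH (hRH : RiemannHypothesis) :
    ∀ᶠ a : ℝ in atTop, pntFloor a - 1.202 ≤ farCoercivityFloor a := by
  filter_upwards [eventually_farFloorDiscrepancy_ge_of_RH hRH (show (0 : ℝ) < 0.0001 by norm_num)] with a h
  have hγ := Literature.Analysis.SpecialFunctions.Real.eulerMascheroniConstant_lt_d8
  have hβ := nicolasBeta_lt'
  linarith

end FloorCoshZeroSum

end Summit.RiemannHypothesis.RiemannHypothesis.Theorems.WeilFormatC
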